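import Summits.BirchSwinnertonDyer.BirchSwinnertonDyer.Theorems.ThetaPartnerAtTwoMazurTateCongruenceAtTwoTopOfManinConstant
import HarnessLib

/-!
# K1 recipe certificate (lead tp2-p1 g13, scratch — NOT a tree proposal): the crux `MazurTateCongruenceAtTwoTop`
# (stmt-25797 = 21416 BY NAME) from binders the route's `closes` ALREADY has: conjuncts SD (.2.1) and Bz (.2.2.1) of
# `PublishedInputsHeckeAtTwo` (item 27435) and `RealPeriodPlusPeriodUnitAtTwoSupply` (item 24944 = the period fact at 2 BY NAME,
# binder `hPer2` of closes). So K1's print debt beyond the closes' other binders is PUB² {SD, Bz}; Abbes–Ullmo (AU, .2.2.2.2) is not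
# needed for K1 once `hPer2` is used (AU ⟹ hPer2 by `SkinnerUrban2014.realPeriodRat_eq_unit_mul_plusPeriod_two_fact_of_abbesUllmo`).
# HONEST FRAMING: conditional on the displayed named facts; BSD is not proved by any of this.
-/

set_option linter.dupNamespace false
set_option autoImplicit false

namespace Summit.BirchSwinnertonDyer.BirchSwinnertonDyer.Cruxes.MazurTateCongruenceAtTwoTop.RecipePer2

open Summit.BirchSwinnertonDyer.BirchSwinnertonDyer.Theses.ThetaPartnerAtTwo
open Summit.BirchSwinnertonDyer.BirchSwinnertonDyer.Theorems

/-- K1 BY NAME from the closes' binders `hPUB` (27435: only SD and Bz used) and `hPer2` (24944). -/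
theorem mazurTateCongruenceAtTwoTop_of_pub_per2 (hPUB : PublishedInputsHeckeAtTwo)
    (hPer2 : RealPeriodPlusPeriodUnitAtTwoSupply) : MazurTateCongruenceAtTwoTop :=
  MazurTateCongruenceAtTwoR.mazurTateCongruenceAtTwoTop_of_sdBz_periodTwo hPUB.2.1 hPUB.2.2.1 hPer2

/-- The twin 21416 BY NAME from the same two binders. -/
theorem mazurTateCongruenceAtTwoR_of_pub_per2 (hPUB : PublishedInputsHeckeAtTwo)
    (hPer2 : RealPeriodPlusPeriodUnitAtTwoSupply) : MazurTateCongruenceAtTwoR :=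
  mazurTateCongruenceAtTwoTop_of_pub_per2 hPUB hPer2

/-- PUB² form: K1 from exactly {SD, Bz} + the period fact at 2 (all three are cite-level named facts held by the route). -/
theorem mazurTateCongruenceAtTwoTop_of_sd_bz_per2
    (hSD : Literature.NumberTheory.EllipticCurves.ModularForms.heckeSelfDual_torsionBy_J0)
    (hBz : Literature.NumberTheory.EllipticCurves.ModularForms.buzzard2000_multiplicityOne_gamma0)
    (hPer2 : RealPeriodPlusPeriodUnitAtTwoSupply) : MazurTateCongruenceAtTwoTop :=
  MazurTateCongruenceAtTwoR.mazurTateCongruenceAtTwoTop_of_sdBz_periodTwo hSD hBz hPer2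

end Summit.BirchSwinnertonDyer.BirchSwinnertonDyer.Cruxes.MazurTateCongruenceAtTwoTop.RecipePer2
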